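import Literature.GroupTheory.CombinatorialGroupTheory.NielsenGeneratingTuples
import Mathlib.Logic.Equiv.Fintype
import HarnessLib

/-!
# Normal form of generating tuples of a free group under Nielsen transformations

Topic `Literature/GroupTheory/CombinatorialGroupTheory`.  **Every finite generating tuple of a
free group of finite rank is Nielsen equivalent to a basis padded with trivial entries**
(Lyndon–Schupp, *Combinatorial Group Theory* (1977/2001), Ch. I, Prop. 2.7 and its proof: *"`X`
can be carried by a Nielsen transformation into some `U` … N-reduced followed by `1`'s … each
`x ∈ X` has the form `x = u^{±1}` … `X^{±1} = U₁^{±1}`"*; J. Nielsen, Math. Ann. 91 (1924)):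

* `exists_lift_comp_basisImage_eq_basis` — for `u : Fin n → F(x₀, …, x_{k-1})` with
  `Gp(u) = F` and an injection `e : Fin k → Fin n` there is an automorphism `ε` of `F(Fin n)`
  whose Nielsen transform `û ∘ U_ε` of `u` is `xⱼ` at position `e j` and `1` off `range e`;
* `exists_mulAut_lift_apply_eq_basis` — the same for arbitrary finite index and basis types,
  phrased through `û (ε xᵢ)`.

Proof (`NielsenGeneratingTuples.lean`): minimise the measure over the Nielsen class; the
minimal tuple consists of trivial entries and signed basis letters (`exists_eq_sgen_of_min`),
each letter exactly once up to sign (`letter_ne_of_min`, `exists_of_eq_val_of_min`); fix the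
signs by a diagonal automorphism (`exists_mulAut_apply_of_eq_ite`, transformations (T1)) and
the positions by a permutation of the index set (`FreeGroup.freeGroupCongr`, (T3)).

## References

* R. C. Lyndon, P. E. Schupp, *Combinatorial Group Theory*, Springer (1977); Classics in
  Mathematics (2001), Ch. I §2, Prop. 2.2, Cor. 2.4, Prop. 2.7. [LyndonSchupp2001]
* J. Nielsen, *Die Isomorphismengruppe der freien Gruppen*, Math. Ann. 91 (1924), 169–209.
  [Nielsen1924]
-/

namespace Literature.GroupTheory.CombinatorialGroupTheory

open List

section Fin

variable {n k : ℕ}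

/-- The nontrivial entries of a minimal generating tuple are signed letters
(`norm_eq_one_of_min`). [cite: LyndonSchupp2001, Ch. I Prop. 2.7] -/
theorem exists_eq_sgen_of_min (u : Fin n → FreeGroup (Fin k))
    (hu : ∀ ε : MulAut (FreeGroup (Fin n)),
      ¬ toLex (∑ i, ((⇑(FreeGroup.lift u) ∘ basisImage ε) i).norm,
            ∑ i, lexWeight ((⇑(FreeGroup.lift u) ∘ basisImage ε) i)) <
          toLex (∑ i, (u i).norm, ∑ i, lexWeight (u i)))
    (hgen : Subgroup.closure (Set.range u) = ⊤) (j : Fin n) (hj : u j ≠ 1) :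
    ∃ p : Fin k × Bool, u j = sgen p.1 p.2 := by
  have h1 := norm_eq_one_of_min u hu hgen j hj
  simp only [FreeGroup.norm] at h1
  obtain ⟨p, hp⟩ := List.length_eq_one_iff.1 h1
  exact ⟨p, by rw [← FreeGroup.mk_toWord (x := u j), hp, sgen]⟩

/-- Signed letters are determined by their values. [folklore] -/
theorem sgen_injective {x y : Fin k} {s t : Bool} (h : sgen x s = sgen y t) : x = y ∧ s = t := by
  have := congrArg FreeGroup.toWord h
  simp only [sgen, FreeGroup.toWord_mk, FreeGroup.reduce_singleton, List.cons.injEq,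
    Prod.mk.injEq, and_true] at this
  exact this

/-- **Distinct entries of a minimal tuple are not equal or inverse letters**: if `uᵢ = x^{±1}`
and `uⱼ = x^{±1}` with `i ≠ j`, replacing `uⱼ` by `uⱼ uᵢ^{∓1} = 1` would lower the total
length. [cite: LyndonSchupp2001, Ch. I §2, proof of Prop. 2.2] -/
theorem letter_ne_of_min (u : Fin n → FreeGroup (Fin k))
    (hu : ∀ ε : MulAut (FreeGroup (Fin n)),
      ¬ toLex (∑ i, ((⇑(FreeGroup.lift u) ∘ basisImage ε) i).norm,
            ∑ i, lexWeight ((⇑(FreeGroup.lift u) ∘ basisImage ε) i)) <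
          toLex (∑ i, (u i).norm, ∑ i, lexWeight (u i)))
    {i j : Fin n} (hij : i ≠ j) {x : Fin k} {s t : Bool} (hi : u i = sgen x s)
    (hj : u j = sgen x t) : False := by
  obtain ⟨c, hc⟩ : ∃ c : Bool, val u (i, c) = (sgen x t)⁻¹ := by
    by_cases hst : s = t
    · exact ⟨false, by rw [val_false, hi, hst]⟩
    · refine ⟨true, ?_⟩
      rw [val_true, hi, ← sgen_not]
      cases s <;> cases t <;> simp_all
  obtain ⟨ε, hval, hrest⟩ := exists_val_lift_comp_basisImage_eq_left u (j, true) (i, c) hij.symm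
  refine hu ε (toLex_lt_of_norm_lt (j, true) ?_ hrest)
  rw [hval, val_true, hc, hj, mul_inv_cancel, FreeGroup.norm_one, Nat.pos_iff_ne_zero, Ne,
    FreeGroup.norm_eq_zero]
  cases t <;> simp [FreeGroup.of_ne_one]

/-- **Diagonal sign changes**: for every set `P` of basis elements there is an automorphism of
`F(ι)` inverting the basis elements in `P` and fixing the others (a product of transformations
(T1); an involution). [cite: LyndonSchupp2001, Ch. I §2 (T1)] -/
theorem exists_mulAut_apply_of_eq_ite {ι : Type*} (P : ι → Prop) [DecidablePred P] :
    ∃ δ : MulAut (FreeGroup ι),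
      ∀ j, δ (FreeGroup.of j) = if P j then (FreeGroup.of j)⁻¹ else FreeGroup.of j := by
  set D : FreeGroup ι →* FreeGroup ι :=
    FreeGroup.lift fun j => if P j then (FreeGroup.of j)⁻¹ else FreeGroup.of j with hD
  have hDof : ∀ j, D (FreeGroup.of j) = if P j then (FreeGroup.of j)⁻¹ else FreeGroup.of j :=
    fun j => FreeGroup.lift_apply_of
  have hDD : D.comp D = MonoidHom.id _ :=
    FreeGroup.ext_hom _ _ fun j => by by_cases h : P j <;> simp [hDof, h]
  exact ⟨D.toMulEquiv D hDD hDD, hDof⟩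

/-- The Nielsen transform by a permutation of the index set re-indexes the tuple
(transformation (T3)). [cite: LyndonSchupp2001, Ch. I §2 (T3)] -/
theorem lift_comp_basisImage_freeGroupCongr {G : Type*} [Group G] (u : Fin n → G)
    (σ : Equiv.Perm (Fin n)) (i : Fin n) :
    (⇑(FreeGroup.lift u) ∘ basisImage (FreeGroup.freeGroupCongr σ : MulAut (FreeGroup (Fin n)))) i =
      u (σ i) := by
  simp [basisImage, FreeGroup.map.of]

/-- **Normal form of generating tuples, `Fin` version** (Lyndon–Schupp, Ch. I, Prop. 2.7;
Nielsen 1924): if `u : Fin n → F(x₀, …, x_{k-1})` generates and `e : Fin k → Fin n` is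
injective, some Nielsen transform of `u` is `xⱼ` at position `e j` and `1` off `range e`.
[cite: LyndonSchupp2001, Ch. I Prop. 2.7] -/
theorem exists_lift_comp_basisImage_eq_basis (u : Fin n → FreeGroup (Fin k))
    (hgen : Subgroup.closure (Set.range u) = ⊤) (e : Fin k → Fin n) (he : Function.Injective e) :
    ∃ ε : MulAut (FreeGroup (Fin n)),
      (∀ x, (⇑(FreeGroup.lift u) ∘ basisImage ε) (e x) = FreeGroup.of x) ∧
      (∀ i, i ∉ Set.range e → (⇑(FreeGroup.lift u) ∘ basisImage ε) i = 1) := by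
  classical
  obtain ⟨ε₀, hmin⟩ := exists_forall_not_lt u
  set v := ⇑(FreeGroup.lift u) ∘ basisImage ε₀ with hv
  have hvgen : Subgroup.closure (Set.range v) = ⊤ := by
    rw [hv, closure_range_lift_comp_basisImage, hgen]
  -- the letters of the nontrivial entries
  choose ℓ hℓ using fun (j : Fin n) (hj : v j ≠ 1) => exists_eq_sgen_of_min v hmin hvgen j hj
  set J := {j : Fin n // v j ≠ 1} with hJ
  set ℓJ : J → Fin k × Bool := fun j => ℓ j.1 j.2 with hℓJ_def
  have hℓJ : ∀ j : J, v j.1 = sgen (ℓJ j).1 (ℓJ j).2 := fun j => hℓ j.1 j.2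
  -- fix the signs
  obtain ⟨δ, hδ⟩ := exists_mulAut_apply_of_eq_ite
    (fun i : Fin n => ∃ h : v i ≠ 1, (ℓJ ⟨i, h⟩).2 = false)
  set v' := ⇑(FreeGroup.lift v) ∘ basisImage δ with hv'
  have hv'₁ : ∀ j : J, v' j.1 = FreeGroup.of (ℓJ j).1 := by
    rintro ⟨i, hi⟩
    have hp := hℓJ ⟨i, hi⟩
    rw [hv', Function.comp_apply, basisImage, hδ]
    by_cases hs : (ℓJ ⟨i, hi⟩).2 = false
    · rw [if_pos ⟨hi, hs⟩, map_inv, FreeGroup.lift_apply_of]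
      generalize ℓJ ⟨i, hi⟩ = q at hp hs ⊢
      rw [hp, hs, sgen_false, inv_inv]
    · rw [if_neg (fun ⟨_, h'⟩ => hs h'), FreeGroup.lift_apply_of]
      generalize ℓJ ⟨i, hi⟩ = q at hp hs ⊢
      obtain ⟨x, s⟩ := q
      cases s
      · exact absurd rfl hs
      · rw [hp, sgen_true]
  have hv'₂ : ∀ i, v i = 1 → v' i = 1 := by
    intro i hi
    rw [hv', Function.comp_apply, basisImage, hδ, if_neg (fun ⟨h, _⟩ => h hi),
      FreeGroup.lift_apply_of, hi]
  -- the letter map is a bijection from the nontrivial positions onto the basis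
  have hinj : Function.Injective fun j : J => (ℓJ j).1 := by
    intro j₁ j₂ h
    by_contra hne
    have hne' : j₁.1 ≠ j₂.1 := fun h' => hne (Subtype.ext h')
    have h1 := hℓJ j₁
    simp only at h
    rw [h] at h1
    exact letter_ne_of_min v hmin hne' h1 (hℓJ j₂)
  have hsurj : Function.Surjective fun j : J => (ℓJ j).1 := by
    intro x
    obtain ⟨a, ha, hax⟩ := exists_of_eq_val_of_min v hmin hvgen x
    refine ⟨⟨a.1, ha⟩, ?_⟩
    show (ℓJ ⟨a.1, ha⟩).1 = x
    have h1 := hℓJ ⟨a.1, ha⟩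
    generalize ℓJ ⟨a.1, ha⟩ = q at h1 ⊢
    obtain ⟨i, s⟩ := a
    cases s
    · rw [val_false, h1, ← sgen_not, ← sgen_true] at hax
      exact (sgen_injective hax).1.symm
    · rw [val_true, h1, ← sgen_true] at hax
      exact (sgen_injective hax).1.symm
  set g : J ≃ Fin k := Equiv.ofBijective _ ⟨hinj, hsurj⟩ with hg
  -- move the letters to the prescribed positions
  obtain ⟨σ, hσ⟩ := Equiv.Perm.exists_extending_pair e (fun x => (g.symm x).1) he
    (Subtype.val_injective.comp g.symm.injective)
  refine ⟨ε₀ * δ * (FreeGroup.freeGroupCongr σ : MulAut (FreeGroup (Fin n))),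
    fun x => ?_, fun i hi => ?_⟩
  · rw [lift_comp_basisImage_mul, lift_comp_basisImage_mul, ← hv, ← hv',
      lift_comp_basisImage_freeGroupCongr, hσ, hv'₁ (g.symm x)]
    exact congrArg FreeGroup.of (g.apply_symm_apply x)
  · rw [lift_comp_basisImage_mul, lift_comp_basisImage_mul, ← hv, ← hv',
      lift_comp_basisImage_freeGroupCongr]
    apply hv'₂
    by_contra hne
    have hx : (g.symm (g ⟨σ i, hne⟩)).1 = σ i := by rw [Equiv.symm_apply_apply]
    rw [← hσ] at hx
    exact hi ⟨_, σ.injective hx⟩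

end Fin

/-- **Normal form of generating tuples under Nielsen transformations** (Lyndon–Schupp, Ch. I,
Prop. 2.7; Nielsen 1924): if a finite tuple `u : ι → F(κ)` generates the free group on the
finite set `κ` and `e : κ → ι` is injective, then for some automorphism `ε` of `F(ι)` the
Nielsen transform `(û(ε xᵢ))ᵢ` of `u` is the basis element `x` at position `e x` and `1` at
the positions outside the range of `e` — "`u` is Nielsen equivalent to the basis padded with
`1`'s"; equivalently, the epimorphism `û : F(ι) → F(κ)` is the standard projection up to an
automorphism of `F(ι)`. [cite: LyndonSchupp2001, Ch. I Prop. 2.7] -/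
theorem exists_mulAut_lift_apply_eq_basis {ι κ : Type*} [Finite ι] [Finite κ]
    (u : ι → FreeGroup κ) (hgen : Subgroup.closure (Set.range u) = ⊤) (e : κ → ι)
    (he : Function.Injective e) :
    ∃ ε : MulAut (FreeGroup ι),
      (∀ x, FreeGroup.lift u (ε (FreeGroup.of (e x))) = FreeGroup.of x) ∧
      (∀ i, i ∉ Set.range e → FreeGroup.lift u (ε (FreeGroup.of i)) = 1) := by
  obtain ⟨n, ⟨gι⟩⟩ := Finite.exists_equiv_fin ι
  obtain ⟨k, ⟨gκ⟩⟩ := Finite.exists_equiv_fin κ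
  -- transport the tuple to `Fin n → F(Fin k)`
  set u' : Fin n → FreeGroup (Fin k) := fun i => FreeGroup.freeGroupCongr gκ (u (gι.symm i))
    with hu'
  have hlift : FreeGroup.lift u' = (FreeGroup.freeGroupCongr gκ).toMonoidHom.comp
      ((FreeGroup.lift u).comp (FreeGroup.freeGroupCongr gι.symm).toMonoidHom) :=
    FreeGroup.ext_hom _ _ fun j => by simp [hu', FreeGroup.map.of]
  have hsurj : Function.Surjective (FreeGroup.lift u) := by
    rw [← MonoidHom.range_eq_top, FreeGroup.range_lift_eq_closure, hgen]
  have hgen' : Subgroup.closure (Set.range u') = ⊤ := by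
    rw [← FreeGroup.range_lift_eq_closure, MonoidHom.range_eq_top, hlift]
    exact (FreeGroup.freeGroupCongr gκ).surjective.comp
      (hsurj.comp (FreeGroup.freeGroupCongr gι.symm).surjective)
  have hcomp : ∀ y, FreeGroup.lift u (FreeGroup.freeGroupCongr gι.symm y) =
      (FreeGroup.freeGroupCongr gκ).symm (FreeGroup.lift u' y) := by
    intro y
    rw [hlift]
    simp only [MonoidHom.comp_apply, MulEquiv.coe_toMonoidHom, MulEquiv.symm_apply_apply]
  -- the normal form there
  have he' : Function.Injective (gι ∘ e ∘ gκ.symm) :=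
    gι.injective.comp (he.comp gκ.symm.injective)
  obtain ⟨ε', h1, h2⟩ := exists_lift_comp_basisImage_eq_basis u' hgen' _ he'
  simp only [Function.comp_apply, basisImage] at h1 h2
  set ε : MulAut (FreeGroup ι) :=
    (FreeGroup.freeGroupCongr gι).trans (ε'.trans (FreeGroup.freeGroupCongr gι.symm)) with hε
  have key : ∀ i, FreeGroup.lift u (ε (FreeGroup.of i)) =
      (FreeGroup.freeGroupCongr gκ).symm (FreeGroup.lift u' (ε' (FreeGroup.of (gι i)))) := by
    intro i
    have hofi : FreeGroup.freeGroupCongr gι (FreeGroup.of i) = FreeGroup.of (gι i) := by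
      simp [FreeGroup.map.of]
    rw [← hcomp, hε, MulEquiv.trans_apply, MulEquiv.trans_apply, hofi]
  refine ⟨ε, fun x => ?_, fun i hi => ?_⟩
  · have := h1 (gκ x)
    simp only [Equiv.symm_apply_apply] at this
    rw [key, this, FreeGroup.freeGroupCongr_symm, FreeGroup.freeGroupCongr_apply, FreeGroup.map.of,
      Equiv.symm_apply_apply]
  · rw [key, h2 (gι i), map_one]
    rintro ⟨y, hy⟩
    exact hi ⟨gκ.symm y, gι.injective (by simpa using hy)⟩

end Literature.GroupTheory.CombinatorialGroupTheory
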